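import Summits.BirchSwinnertonDyer.BirchSwinnertonDyer.Theorems.BiquadraticEisensteinDescentEisensteinHeartFlatCMInertBadKPrimeGenus
import Literature.NumberTheory.GaloisRepresentations.CMTypeHeckeCharacter
import HarnessLib

set_option linter.dupNamespace false -- `Summit.BirchSwinnertonDyer.BirchSwinnertonDyer.Theorems.…` (summit = sub, D-0017)
set_option autoImplicit false

/-!
# Crux `EisensteinHeartFlatCMInertBadKPrime` (stmt-BirchSwinnertonDyer-21341), line `hsieh-lambda`, layer 2:
# the ϑ/D-DATUM of the Katz existence fact at the biquadratic frame, in ONE call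

Route `BiquadraticEisensteinDescent` (width seat `bsd-wall-cm-bed-w2` g7; sequel of `…Theta.lean` (p621824) and
`…Genus.lean` (p622603)). THEOREMS ONLY (no definition, no named fact, no `sorry`). BSD is not proved by any of this;
nothing here asserts the crux's input.

`KatzCM.exists_isBaseChangeLine` / `KatzCM.exists_isLine` (`Literature/…/KatzPAdicLFunctionCMFieldBaseChangeLine.lean`)
take, on the ϑ/D side: `{ϑ : L}`, `hϑ₁ : ∀ σ, (σ ϑ).re = 0`, `hϑ₂ : ∀ σ, KatzCM.InSigma ι Sp σ → 0 < (σ ϑ).im`,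
`{S T D}`, `hD₁ : KatzCM.primesOver L p ⊆ D`, `hD₂ : S ⊆ D`, `hD₃ : ∀ w ∈ S, c • w ∈ D`,
`hD₄ : ∀ w, e(w ∣ L⁺) ≠ 1 → w ∈ D`, `hd2 : ∀ w ∈ D, ordAt w (2ϑ) = differentExponentAt w`.

* **`exists_theta_datum`** — at the frame (`K = K′` with `[K:ℚ] = 2`, `y² = d_K < 0`, `L = K(x)` CM with `[L:K] ≤ 2`,
  `x² = d ∈` the nine CM discriminants, `gcd(d, d_K) = 1`; `P` any finite set of primes `∌` divisors of `d_K` with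
  `p ∈ P`; `S` any finite set of primes of `L` each above some `ℓ ∈ P`; the CM type `Σ` oriented by
  `hSigma : InSigma ι Sp σ → σ|_K = φ̄₀`, `Im φ₀(y) < 0` — w2 g6's `…SigmaOrientation.inSigma_singleton_iff`):
  **∃ ϑ D T with ALL of `hϑ₁ hϑ₂ hTS hT hST hD₁ hD₂ hD₃ hD₄ hd2`**, for `D := {w : w ∣ ∏_{ℓ ∈ P} ℓ}` and `T` a
  transversal of the split primes of `S` (`exists_transversal`, §0).
* `mem_primesAbove_iff` — bookkeeping of that `D` (`w ∈ D ↔ ∃ ℓ ∈ P, ℓ ∈ w`).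

What the instantiator still supplies to the fact: `hS` (`p ∉ w` for `w ∈ S`), `hlam` (λ unramified off `S ∪ {w ∣ p}`),
`hunr` (w2 g6 `…BiquadraticCMType.not_dvd_discr_maximalRealSubfield`), `hSp` (`…isPAdicCMType_singleton`), (T), (L),
the named fact.
[cite: Hsieh2014mu, §3.1 (d1) (d2), §4.8]
-/

noncomputable section

open scoped nonZeroDivisors NumberField Pointwise

namespace Summit.BirchSwinnertonDyer.BirchSwinnertonDyer.Theorems.BiquadraticEisensteinDescentEisensteinHeartFlatCMInertBadKPrimeThetaDatum

open NumberField IsDedekindDomain Literature.NumberTheory.EllipticCurves Literature.NumberTheory.Automorphic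
open Summit.BirchSwinnertonDyer.BirchSwinnertonDyer.Theorems.BiquadraticEisensteinDescentEisensteinHeartFlatCMInertBadKPrimeTheta
open Summit.BirchSwinnertonDyer.BirchSwinnertonDyer.Theorems.BiquadraticEisensteinDescentEisensteinHeartFlatCMInertBadKPrimeGenus

variable {K : Type} [Field K] [NumberField K] {L : Type} [Field L] [NumberField L] [Algebra K L]

/-! ## §0 A transversal of an involution on a finite set (the set `T` of the fact) -/

/-- **Half-systems exist**: for an involution `c` on a type and a finite set `S`, there is `T ⊆ S` containing no
`c`-fixed point, never both of `w, c w`, and meeting every non-fixed `c`-orbit of `S` — the shape of the Katz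
fact's `T = supp 𝔉` («exactly one of `w, cw` for each split `w ∈ S`»). [cite: Hsieh2014mu, §3.1 (the ideals `𝔉`, `𝔉_c`)] -/
theorem exists_transversal {α : Type} [DecidableEq α] (c : α → α) (hc : ∀ a, c (c a) = a) (S : Finset α) :
    ∃ T : Finset α, T ⊆ S ∧ (∀ w ∈ T, c w ≠ w ∧ c w ∉ T) ∧ (∀ w ∈ S, c w ≠ w → (w ∈ T ∨ c w ∈ T)) := by
  induction S using Finset.induction with
  | empty => exact ⟨∅, Finset.empty_subset _, fun w hw ↦ absurd hw (Finset.notMem_empty w), fun w hw ↦ absurd hw (Finset.notMem_empty w)⟩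
  | insert w S' hwS' ih =>
    obtain ⟨T', hT'S, hT', hST'⟩ := ih
    by_cases hfix : c w = w
    · refine ⟨T', hT'S.trans (Finset.subset_insert _ _), hT', fun u hu hcu ↦ ?_⟩
      rcases Finset.mem_insert.mp hu with rfl | hu'
      · exact absurd hfix hcu
      · exact hST' u hu' hcu
    by_cases hcw : c w ∈ T'
    · refine ⟨T', hT'S.trans (Finset.subset_insert _ _), hT', fun u hu hcu ↦ ?_⟩
      rcases Finset.mem_insert.mp hu with rfl | hu'
      · exact Or.inr hcw
      · exact hST' u hu' hcu
    · refine ⟨insert w T', Finset.insert_subset_insert _ hT'S, fun u hu ↦ ?_, fun u hu hcu ↦ ?_⟩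
      · rcases Finset.mem_insert.mp hu with rfl | hu'
        · refine ⟨hfix, fun h ↦ ?_⟩
          rcases Finset.mem_insert.mp h with h | h
          · exact hfix h
          · exact hcw h
        · obtain ⟨h1, h2⟩ := hT' u hu'
          refine ⟨h1, fun h ↦ ?_⟩
          rcases Finset.mem_insert.mp h with h | h
          · -- `c u = w` forces `u = c w ∈ T'`
            apply hcw
            rw [← h, hc]
            exact hu'
          · exact h2 h
      · rcases Finset.mem_insert.mp hu with rfl | hu'
        · exact Or.inl (Finset.mem_insert_self _ _)
        · rcases hST' u hu' hcu with h | h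
          · exact Or.inl (Finset.mem_insert_of_mem h)
          · exact Or.inr (Finset.mem_insert_of_mem h)

/-! ## §1 The set `D = {w : w ∣ ∏_{ℓ ∈ P} ℓ}` -/

/-- The primes of `L` above the primes of a finite set `P` form a finite set (the prime factors of
`(∏_{ℓ∈P} ℓ)·𝓞_L`), and `w` is one of them iff `ℓ ∈ w` for some `ℓ ∈ P`. [cite: NeukirchANT1999, Ch. I §8] -/
theorem mem_primesAbove_iff (P : Finset ℕ) (w : HeightOneSpectrum (𝓞 L))
    (hfin : ({v : HeightOneSpectrum (𝓞 L) | v.asIdeal ∣ Ideal.span {((∏ ℓ ∈ P, ℓ : ℕ) : 𝓞 L)}}).Finite) :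
    w ∈ hfin.toFinset ↔ ∃ ℓ ∈ P, ((ℓ : ℕ) : 𝓞 L) ∈ w.asIdeal := by
  rw [Set.Finite.mem_toFinset, Set.mem_setOf_eq, Ideal.dvd_span_singleton, Nat.cast_prod,
    Ideal.IsPrime.prod_mem_iff (hp := w.isPrime)]

/-! ## §2 The datum -/

/-- **The ϑ/D-datum of the Katz existence fact at the biquadratic frame, in one call.** See the module
docstring for the seven conclusions; `ϑ = (a·y + b·x)/2` of `…Theta.exists_theta`, `D = {w ∣ ∏_{ℓ∈P} ℓ}`, `hD₄` by
genus theory (`…Genus.hD4_of_frame_of_mem`). [cite: Hsieh2014mu, §3.1 (d1) (d2), §4.8] -/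
theorem exists_theta_datum [IsCMField L] (hK2 : Module.finrank ℚ K = 2) (h2 : Module.finrank K L ≤ 2)
    {x : L} {d : ℤ} (hgen : Algebra.adjoin K {x} = ⊤) (hx : x ^ 2 = (d : L))
    (hd : d = -3 ∨ d = -4 ∨ d = -7 ∨ d = -8 ∨ d = -11 ∨ d = -19 ∨ d = -43 ∨ d = -67 ∨ d = -163)
    {y : K} (hy : y ^ 2 = (NumberField.discr K : K)) (hdK : NumberField.discr K < 0)
    (hcop : ∀ ℓ : ℕ, ℓ.Prime → (ℓ : ℤ) ∣ d → ¬ (ℓ : ℤ) ∣ NumberField.discr K)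
    {φ₀ : K →+* ℂ} (hφ₀ : (φ₀ y).im < 0)
    (P : Finset ℕ) (hP : ∀ ℓ ∈ P, ℓ.Prime) (hPK : ∀ ℓ ∈ P, ¬ (ℓ : ℤ) ∣ NumberField.discr K)
    {p : ℕ} [Fact p.Prime] (hpP : p ∈ P)
    (S : Finset (HeightOneSpectrum (𝓞 L))) (hSP : ∀ w ∈ S, ∃ ℓ ∈ P, ((ℓ : ℕ) : 𝓞 L) ∈ w.asIdeal)
    {ι : PadicAlgCl p ≃+* ℂ} {Sp : Finset (HeightOneSpectrum (𝓞 L))}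
    (hSigma : ∀ σ : L →+* ℂ, KatzCM.InSigma ι Sp σ →
      σ.comp (algebraMap K L) = NumberField.ComplexEmbedding.conjugate φ₀) :
    ∃ (ϑ : L) (D T : Finset (HeightOneSpectrum (𝓞 L))),
      (∀ σ : L →+* ℂ, (σ ϑ).re = 0) ∧
      (∀ σ : L →+* ℂ, KatzCM.InSigma ι Sp σ → 0 < (σ ϑ).im) ∧
      T ⊆ S ∧ (∀ w ∈ T, IsCMField.complexConj L • w ≠ w ∧ IsCMField.complexConj L • w ∉ T) ∧
      (∀ w ∈ S, IsCMField.complexConj L • w ≠ w → (w ∈ T ∨ IsCMField.complexConj L • w ∈ T)) ∧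
      KatzCM.primesOver L p ⊆ D ∧ S ⊆ D ∧
      (∀ w ∈ S, IsCMField.complexConj L • w ∈ D) ∧
      (∀ w : HeightOneSpectrum (𝓞 L), w.asIdeal.ramificationIdx (𝓞 (maximalRealSubfield L)) ≠ 1 → w ∈ D) ∧
      (∀ w ∈ D, ordAt w (2 * ϑ) = differentExponentAt w) := by
  classical
  obtain ⟨ϑ, hd1, hpos, hd2⟩ := exists_theta_of_mem L h2 hgen hx hd hy hdK hφ₀ P hP hPK
  -- the transversal `T` (`c` is an involution on the primes)
  obtain ⟨T, hTS, hT, hST⟩ := exists_transversal (fun w ↦ IsCMField.complexConj L • w)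
    (fun w ↦ by
      have h2 : IsCMField.complexConj L ^ 2 = 1 := by
        rw [← IsCMField.orderOf_complexConj L]; exact pow_orderOf_eq_one _
      change IsCMField.complexConj L • (IsCMField.complexConj L • w) = w
      rw [smul_smul, ← pow_two, h2, one_smul]) S
  -- the set `D`
  have hN0 : ((∏ ℓ ∈ P, ℓ : ℕ) : 𝓞 L) ≠ 0 := by
    exact_mod_cast (Finset.prod_pos fun ℓ hℓ ↦ (hP ℓ hℓ).pos).ne'
  have hfin : ({v : HeightOneSpectrum (𝓞 L) | v.asIdeal ∣ Ideal.span {((∏ ℓ ∈ P, ℓ : ℕ) : 𝓞 L)}}).Finite :=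
    Ideal.finite_factors (by rwa [Ne, Ideal.zero_eq_bot, Ideal.span_singleton_eq_bot])
  refine ⟨ϑ, hfin.toFinset, T, hd1, fun σ hσ ↦ hpos σ (hSigma σ hσ), hTS, hT, hST, ?_, ?_, ?_, ?_, ?_⟩
  · -- `hD₁`: primes above `p`
    intro w hw
    rw [KatzCM.mem_primesOver] at hw
    exact (mem_primesAbove_iff P w hfin).mpr ⟨p, hpP, hw⟩
  · -- `hD₂`: `S ⊆ D`
    intro w hw
    exact (mem_primesAbove_iff P w hfin).mpr (hSP w hw)
  · -- `hD₃`: `c • S ⊆ D` (`c` fixes `ℓ`)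
    intro w hw
    obtain ⟨ℓ, hℓP, hℓw⟩ := hSP w hw
    refine (mem_primesAbove_iff P _ hfin).mpr ⟨ℓ, hℓP, ?_⟩
    rw [HeightOneSpectrum.smul_asIdeal, Ideal.mem_pointwise_smul_iff_inv_smul_mem,
      Literature.NumberTheory.GaloisRepresentations.HeckeCharacter.complexConj_smul_natCast]
    exact hℓw
  · -- `hD₄`: genus theory — vacuous
    exact hD4_of_frame_of_mem hK2 h2 hgen hx hd hy hdK hcop hfin.toFinset
  · -- `hd2` on `D`
    intro w hw
    obtain ⟨ℓ, hℓP, hℓw⟩ := (mem_primesAbove_iff P w hfin).mp hw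
    exact hd2 w ℓ hℓP hℓw

end Summit.BirchSwinnertonDyer.BirchSwinnertonDyer.Theorems.BiquadraticEisensteinDescentEisensteinHeartFlatCMInertBadKPrimeThetaDatum

end
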